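import Literature.Computability.MetaComplexity.MCSPProofs
import HarnessLib

/-!
# `MCSP* ∈ NP` (proofs; partial-function Minimum Circuit Size Problem)

(Companion of `MCSPStarProofs.lean`, which discharges `boolPair_encode_some_mem_MCSPStar_iff` —
`MCSP` as the `⋆`-free case of `MCSP*`; this file is independent of it.)

This file DISCHARGES the named fact `Literature.Computability.MetaComplexity.MCSPStar_mem_NP`
(`MCSP.lean`): the partial-function variant `MCSP*` of the Minimum Circuit Size Problem
(Hirahara, *NP-hardness of learning programs and partial MCSP*, FOCS 2022 / ECCC TR22-119, §1.2
p. 4 and Def. 8.4 p. 30: "The input of `MCSP*` consists of a partial function `f : {0,1}ⁿ → {0,1,*}` and a size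
parameter `s`, and the task is to decide whether there exists a circuit of size `s` that computes
`f(x)` on input `x` such that `f(x) ≠ *`"; its membership in `NP` is the folklore guess-and-check
observation, as for `MCSP`, Kabanets–Cai 2000, §2) lies in `NP = ∃ᵖ·P`: `MCSPStar_mem_NP_holds`.

The proof follows `MCSPProofs.lean` (`MCSP_mem_NP_holds`) and reuses its verifier bricks
(namespace `MCSPVerif`: the fields `ttF, sbF, nuF, prF`, the conditions `WF`, `CANON`, `POW`,
`CLEAN`, `SIZE`, `PROJ`, the evaluator answer `ansF`, the cube order `lowBits`). What is new is
the *format* of the instance: the first component is no longer a bare truth table but the code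
`(encodingBoolBool.optionBool).listBool.encode L` of a list `L : List (Option Bool)` of length
`2ⁿ`, i.e. `boolPair 1^{|L|} (tableBody L)` where `tableBody L` is the concatenation of the blocks `0001`
(`none`), `11bb01` (`some b`). Three finite-state transducers over this body (one parser
`MCSPStarVerif.bsStep`, three emissions) compute the mask `L.map isSome`, the values
`L.map (·.getD false)` and the validity bit "the body parses into whole blocks"
(`validT_eval_eq_iff`: the parse ends at a block boundary iff the body is `tableBody L` for some `L`).
The verifier `MCSPStarVerif.VerStar` then checks: the instance is a pair whose first component is a
pair `⟨h, body⟩` with `body` valid and `h = 1^{#blocks}` (so the first component is exactly a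
`listBool` code), `#blocks = 2^{|ν|}` (`POW` of `MCSPProofs` on the mask), the size numeral is
canonical, the program `D` of the certificate `⟨1ⁿ, D⟩` is clean, every row `i < |z|` is
consistent — `i ≥ #blocks`, or the `i`-th entry is `none`, or its value is the evaluator's
answer on the `i`-th point of the cube — and `#TAB D ≤ s ≠ 0` or `D` is a bare rotation code.
Soundness uses Theorem R of `CircuitEvalPrograms.lean` (`exists_circuit_evalFn`) and
`vmSpec_rotCode_proj`; completeness takes an *optimal* circuit for the total function computed by
a consistent circuit (its size is at most `s` and at most `univBound n < 3 |x|`,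
`cktSize_univ_fin`), whose program is a polynomially short certificate.

## References

* S. Hirahara, *NP-hardness of learning programs and partial MCSP*, FOCS 2022, 968–979; full
  version ECCC TR22-119 (2022), §1.2 p. 4 (informal definition of `MCSP*`; "it has been a
  long-standing open problem to extend Levin's NP-completeness result to `MCSP*`") and Def. 8.4
  p. 30 (formal definition; there the size parameter is written in unary, `(f, 1ˢ)` — the tree's
  `MCSPStar` takes `s` in binary, which only makes membership in `NP` (this file) harder and is
  handled by the universal bound `univBound`). Locators refer to the ECCC version.
* V. Kabanets, J.-Y. Cai, *Circuit minimization problem*, STOC 2000, 73–79, §2 (`MCSP ∈ NP`).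
* C. D. Murray, R. R. Williams, *On the (non) NP-hardness of computing circuit complexity*,
  CCC 2015, §1 p. 365 and footnote 1 (the guess-and-check verifier; every function has circuits
  of size `O(2ⁿ n)`).
-/

namespace Literature.Computability.MetaComplexity

open _root_.Computability Complexity Complexity.Classes Complexity.CircEval Complexity.Brick MCSPVerif

namespace MCSPStarVerif

/-! ### The body of a list code and its block parser -/

/-- The *body* `tableBody L` of the `listBool` code of a list of optional bits: the right-nested pairing
`boolPair (enc a₁) (boolPair (enc a₂) (… []))` of the `optionBool` codes `enc none = [0]`,
`enc (some b) = [1, b]`, so that the full code is `boolPair 1^{|L|} (tableBody L)` (`encode_eq_tableBody`).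
[cite: AroraBarak2009, §0.1 (tuples of strings)] -/
def tableBody (L : List (Option Bool)) : List Bool :=
  L.foldr (fun a acc => boolPair ((encodingBoolBool.optionBool).encode a) acc) []

/-- The `listBool` code of `L` is `⟨1^{|L|}, tableBody L⟩` (definitional). [cite: AroraBarak2009, §0.1] -/
theorem encode_eq_tableBody (L : List (Option Bool)) :
    (encodingBoolBool.optionBool).listBool.encode L = boolPair (unaryEncodeNat L.length) (tableBody L) := rfl

/-- The empty body. [folklore] -/
@[simp] theorem tableBody_nil : tableBody [] = [] := rfl

/-- A `none` entry contributes the block `0001`. [folklore] -/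
@[simp] theorem tableBody_cons_none (L : List (Option Bool)) :
    tableBody (none :: L) = false :: false :: false :: true :: tableBody L := by
  simp [tableBody, boolPair, Encoding.optionBool]

/-- A `some b` entry contributes the block `11bb01`. [folklore] -/
@[simp] theorem tableBody_cons_some (b : Bool) (L : List (Option Bool)) :
    tableBody (some b :: L) = true :: true :: b :: b :: false :: true :: tableBody L := by
  simp [tableBody, boolPair, Encoding.optionBool, encodingBoolBool, encodeBool]

/-- `4 |L| ≤ |tableBody L| ≤ 6 |L|`. [folklore] -/
theorem length_tableBody (L : List (Option Bool)) : 4 * L.length ≤ (tableBody L).length ∧ (tableBody L).length ≤ 6 * L.length := by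
  induction L with
  | nil => simp
  | cons a L ih => cases a <;> simp <;> omega

/-- Parser states for bodies: at a block boundary (`b0`), inside a `none` block after `0`, `00`,
`000` (`n1`, `n2`, `n3`), inside a `some` block after `1`, `11`, `11b`, `11bb`, `11bb0`
(`s1`, `s2`, `s3 b`, `s4 b`, `s5 b`), or in the absorbing error state. [folklore] -/
inductive BS
  | b0
  | n1
  | n2
  | n3
  | s1
  | s2
  | s3 (b : Bool)
  | s4 (b : Bool)
  | s5 (b : Bool)
  | err
  deriving DecidableEq, Fintype

/-- The block parser, emitting the symbol `e a` at the end of the block of the entry `a`. [folklore] -/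
def bsStep (e : Option Bool → Bool) : BS → Bool → BS × List Bool
  | .b0, false => (.n1, [])
  | .b0, true => (.s1, [])
  | .n1, false => (.n2, [])
  | .n1, true => (.err, [])
  | .n2, false => (.n3, [])
  | .n2, true => (.err, [])
  | .n3, true => (.b0, [e none])
  | .n3, false => (.err, [])
  | .s1, true => (.s2, [])
  | .s1, false => (.err, [])
  | .s2, b => (.s3 b, [])
  | .s3 b, c => (if c = b then .s4 b else .err, [])
  | .s4 b, false => (.s5 b, [])
  | .s4 _, true => (.err, [])
  | .s5 b, true => (.b0, [e (some b)])
  | .s5 _, false => (.err, [])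
  | .err, _ => (.err, [])

/-- The parsing transducer with emission `e`: output `L.map e` on `tableBody L` (`parseT_eval_tableBody`). [folklore] -/
def parseT (e : Option Bool → Bool) : FST BS Bool Bool where
  init := .b0
  step := bsStep e
  front := fun _ => []
  keep := fun _ => true

/-- The validity transducer: answers `[1]` iff the parse ends at a block boundary. [folklore] -/
def validT : FST BS Bool Bool where
  init := .b0
  step := bsStep fun _ => false
  front := fun s => [decide (s = BS.b0)]
  keep := fun _ => false

/-- The mask transducer: `L.map isSome` on `tableBody L`. [folklore] -/
def maskT : FST BS Bool Bool := parseT fun a => a.isSome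

/-- The value transducer: `L.map (·.getD 0)` on `tableBody L`. [folklore] -/
def valT : FST BS Bool Bool := parseT fun a => a.getD false

/-- The transition of `parseT e` (definitional). [folklore] -/
@[simp] theorem parseT_step (e : Option Bool → Bool) (s : BS) (c : Bool) : (parseT e).step s c = bsStep e s c := rfl

/-- The transition of `validT` (definitional). [folklore] -/
@[simp] theorem validT_step (s : BS) (c : Bool) : validT.step s c = bsStep (fun _ => false) s c := rfl

/-- The validity transducer has the runs of `parseT (fun _ => false)`. [folklore] -/
theorem validT_run (s : BS) (w : List Bool) : validT.run s w = (parseT fun _ => false).run s w := by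
  induction w generalizing s with
  | nil => rfl
  | cons c w ih => simp [FST.run_cons, ih]

/-- The error state is absorbing and silent. [folklore] -/
@[simp] theorem run_err (e : Option Bool → Bool) (w : List Bool) : (parseT e).run .err w = (.err, []) := by
  induction w with
  | nil => rfl
  | cons c w ih => simp [FST.run_cons, bsStep, ih]

/-- **Parsing a body**: from the boundary state, `tableBody L` is consumed back to the boundary state,
emitting `L.map e`. [folklore] -/
theorem run_tableBody (e : Option Bool → Bool) (L : List (Option Bool)) :
    (parseT e).run .b0 (tableBody L) = (.b0, L.map e) := by
  induction L with
  | nil => rfl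
  | cons a L ih =>
    cases a with
    | none => simp [FST.run_cons, bsStep, ih]
    | some b => simp [FST.run_cons, bsStep, ih]

/-- **Inverting the parser**: a word consumed from the boundary state back to the boundary state
is the body of some list. [folklore] -/
theorem exists_tableBody_of_run : ∀ (e : Option Bool → Bool) (N : ℕ) (w : List Bool), w.length ≤ N →
    ((parseT e).run .b0 w).1 = .b0 → ∃ L : List (Option Bool), w = tableBody L
  | _, _, [], _, _ => ⟨[], rfl⟩
  | _, 0, _ :: _, hN, _ => absurd hN (by simp)
  | e, N + 1, false :: w, hN, h => by
    rcases w with _ | ⟨a, w⟩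
    · simp [FST.run_cons, bsStep] at h
    cases a
    swap
    · simp [FST.run_cons, bsStep] at h
    rcases w with _ | ⟨a, w⟩
    · simp [FST.run_cons, bsStep] at h
    cases a
    swap
    · simp [FST.run_cons, bsStep] at h
    rcases w with _ | ⟨a, w⟩
    · simp [FST.run_cons, bsStep] at h
    cases a
    · simp [FST.run_cons, bsStep] at h
    simp only [FST.run_cons, parseT_step, bsStep] at h
    obtain ⟨L, rfl⟩ := exists_tableBody_of_run e N w (by simp at hN; omega) h
    exact ⟨none :: L, by simp⟩
  | e, N + 1, true :: w, hN, h => by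
    rcases w with _ | ⟨a, w⟩
    · simp [FST.run_cons, bsStep] at h
    cases a
    · simp [FST.run_cons, bsStep] at h
    rcases w with _ | ⟨b, w⟩
    · simp [FST.run_cons, bsStep] at h
    rcases w with _ | ⟨c, w⟩
    · simp [FST.run_cons, bsStep] at h
    by_cases hcb : c = b
    swap
    · simp [FST.run_cons, bsStep, hcb] at h
    subst hcb
    rcases w with _ | ⟨a, w⟩
    · simp [FST.run_cons, bsStep] at h
    cases a
    swap
    · simp [FST.run_cons, bsStep] at h
    rcases w with _ | ⟨a, w⟩
    · simp [FST.run_cons, bsStep] at h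
    cases a
    · simp [FST.run_cons, bsStep] at h
    simp only [FST.run_cons, parseT_step, bsStep] at h
    obtain ⟨L, rfl⟩ := exists_tableBody_of_run e N w (by simp at hN; omega) h
    exact ⟨some c :: L, by simp⟩

/-- `parseT e` outputs the emitted word. [folklore] -/
theorem parseT_eval (e : Option Bool → Bool) (w : List Bool) : (parseT e).eval w = ((parseT e).run .b0 w).2 := by
  simp [FST.eval, parseT]

/-- **`(parseT e).eval (tableBody L) = L.map e`.** [folklore] -/
@[simp] theorem parseT_eval_tableBody (e : Option Bool → Bool) (L : List (Option Bool)) :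
    (parseT e).eval (tableBody L) = L.map e := by
  rw [parseT_eval, run_tableBody]

/-- **`maskT.eval (tableBody L) = L.map isSome`.** [folklore] -/
@[simp] theorem maskT_eval_tableBody (L : List (Option Bool)) : maskT.eval (tableBody L) = L.map fun a => a.isSome :=
  parseT_eval_tableBody _ L

/-- **`valT.eval (tableBody L) = L.map (·.getD 0)`.** [folklore] -/
@[simp] theorem valT_eval_tableBody (L : List (Option Bool)) : valT.eval (tableBody L) = L.map fun a => a.getD false :=
  parseT_eval_tableBody _ L

/-- **Validity**: `validT.eval w = [1]` iff `w = tableBody L` for some `L`. [folklore] -/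
theorem validT_eval_eq_iff (w : List Bool) : validT.eval w = [true] ↔ ∃ L : List (Option Bool), w = tableBody L := by
  have hv : validT.eval w = [decide (((parseT fun _ => false).run .b0 w).1 = .b0)] := by
    rw [FST.eval, show validT.init = BS.b0 from rfl, validT_run]
    simp [validT]
  rw [hv]
  simp only [List.cons.injEq, and_true, decide_eq_true_eq]
  exact ⟨exists_tableBody_of_run _ w.length w le_rfl, by rintro ⟨L, rfl⟩; rw [run_tableBody]⟩

/-- `(parseT e).eval ∈ FP`. [folklore] -/
theorem parseT_mem_FP (e : Option Bool → Bool) : (parseT e).eval ∈ FP := (parseT e).polyTimeComputable_eval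

/-- `validT.eval ∈ FP`. [folklore] -/
theorem validT_mem_FP : validT.eval ∈ FP := validT.polyTimeComputable_eval

/-! ### The verifier language -/

/-- The header field `h` of the first component `tte = ⟨h, body⟩` of the instance. [folklore] -/
def hdF : List Bool → List Bool := fstP ∘ ttF
/-- The body field of the first component `tte = ⟨h, body⟩` of the instance. [folklore] -/
def bdF : List Bool → List Bool := sndP ∘ ttF
/-- The mask of the instance: which entries of the partial truth table are defined. [folklore] -/
def maskF : List Bool → List Bool := maskT.eval ∘ bdF
/-- The values of the instance (`0` at the undefined entries). [folklore] -/
def valF : List Bool → List Bool := valT.eval ∘ bdF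

/-- `hdF ∈ FP`. [folklore] -/
theorem hdF_mem_FP : hdF ∈ FP := comp_mem_FP fstP_mem_FP ttF_mem_FP
/-- `bdF ∈ FP`. [folklore] -/
theorem bdF_mem_FP : bdF ∈ FP := comp_mem_FP sndP_mem_FP ttF_mem_FP
/-- `maskF ∈ FP`. [folklore] -/
theorem maskF_mem_FP : maskF ∈ FP := comp_mem_FP (parseT_mem_FP _) bdF_mem_FP
/-- `valF ∈ FP`. [folklore] -/
theorem valF_mem_FP : valF ∈ FP := comp_mem_FP (parseT_mem_FP _) bdF_mem_FP

/-- Reading `h`. [folklore] -/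
@[simp] theorem hdF_boolPair (tte sb y : List Bool) : hdF (boolPair (boolPair tte sb) y) = fstP tte := by
  simp [hdF]
/-- Reading the body. [folklore] -/
@[simp] theorem bdF_boolPair (tte sb y : List Bool) : bdF (boolPair (boolPair tte sb) y) = sndP tte := by
  simp [bdF]
/-- Reading the mask. [folklore] -/
@[simp] theorem maskF_boolPair (tte sb y : List Bool) :
    maskF (boolPair (boolPair tte sb) y) = maskT.eval (sndP tte) := by
  simp [maskF]
/-- Reading the values. [folklore] -/
@[simp] theorem valF_boolPair (tte sb y : List Bool) :
    valF (boolPair (boolPair tte sb) y) = valT.eval (sndP tte) := by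
  simp [valF]

/-- `WF₂`: the first component of the instance is a genuine pair `tte = ⟨h, body⟩`. [folklore] -/
def WF₂ : Language Bool := {z | ttF z = fanoutFn hdF bdF z}

/-- `HDR`: the header is the unary numeral of the number of blocks of the body
(`h = 1^{|mask|}`), as in a `listBool` code. [folklore] -/
def HDR : Language Bool := {z | hdF z = (onesFn ∘ maskF) z}

/-- `VALID`: the body parses into whole blocks. [folklore] -/
def VALID : Language Bool := {z | (validT.eval ∘ bdF) z = (fun _ => [true]) z}

/-- `POWs`: `|mask| = 2^{|ν|}` — the condition `POW` of `MCSPProofs.lean` on the re-paired string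
`⟨⟨mask, sb⟩, y⟩`. [folklore] -/
def POWs : Language Bool := fanoutFn (fanoutFn maskF sbF) sndP ⁻¹' POW

/-- On a row `w = ⟨z, 1ⁱ⟩`: the mask bit `[mask[i]]` (`[]` if `i ≥ |mask|`). [folklore] -/
noncomputable def mbitF : List Bool → List Bool := bitAtFn ∘ fanoutFn sndP (maskF ∘ fstP)

/-- On a row `w = ⟨z, 1ⁱ⟩`: the value bit `[val[i]]` (`[]` if `i ≥ |val|`). [folklore] -/
noncomputable def vbitF : List Bool → List Bool := bitAtFn ∘ fanoutFn sndP (valF ∘ fstP)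

/-- `ROWs`: the row `⟨z, 1ⁱ⟩` is consistent — `i ≥ |mask|`, or the `i`-th entry is undefined
(`⋆`), or its value is the answer of `D` on the `i`-th point of the cube ("computes `f(x)` on
input `x` such that `f(x) ≠ ⋆`"). [cite: Hirahara2022PartialMCSP, §1.2 p. 4 and Def. 8.4 p. 30] -/
def ROWs : Language Bool :=
  {w | mbitF w = (fun _ => []) w} ⊔ {w | mbitF w = (fun _ => [false]) w} ⊔ {w | vbitF w = ansF w}

/-- `MAINs`: all rows `i < |z|` are consistent. [cite: Hirahara2022PartialMCSP, §1.2 p. 4 and Def. 8.4 p. 30] -/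
def MAINs : Language Bool := ballLang Polynomial.X ROWs

/-- **The verifier language of `MCSP*`.** [cite: Hirahara2022PartialMCSP, §1.2 p. 4 and Def. 8.4 p. 30] -/
def VerStar : Language Bool :=
  WF ⊓ WF₂ ⊓ HDR ⊓ VALID ⊓ CANON ⊓ POWs ⊓ CLEAN ⊓ MAINs ⊓ (MCSPVerif.SIZE ⊔ PROJ)

/-! ### The verifier is polynomial time -/

/-- `WF₂ ∈ P`. [folklore] -/
theorem WF₂_mem_P : WF₂ ∈ P := setOf_apply_eq_apply_mem_P ttF_mem_FP (fanoutFn_mem_FP hdF_mem_FP bdF_mem_FP)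

/-- `HDR ∈ P`. [folklore] -/
theorem HDR_mem_P : HDR ∈ P := setOf_apply_eq_apply_mem_P hdF_mem_FP (comp_mem_FP onesFn_mem_FP maskF_mem_FP)

/-- `VALID ∈ P`. [folklore] -/
theorem VALID_mem_P : VALID ∈ P :=
  setOf_apply_eq_apply_mem_P (comp_mem_FP validT_mem_FP bdF_mem_FP) (const_mem_FP _)

/-- `POWs ∈ P`. [folklore] -/
theorem POWs_mem_P : POWs ∈ P :=
  preimage_mem_P POW_mem_P (fanoutFn_mem_FP (fanoutFn_mem_FP maskF_mem_FP sbF_mem_FP) sndP_mem_FP)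

/-- `mbitF ∈ FP`. [folklore] -/
theorem mbitF_mem_FP : mbitF ∈ FP :=
  comp_mem_FP bitAtFn_mem_FP (fanoutFn_mem_FP sndP_mem_FP (comp_mem_FP maskF_mem_FP fstP_mem_FP))

/-- `vbitF ∈ FP`. [folklore] -/
theorem vbitF_mem_FP : vbitF ∈ FP :=
  comp_mem_FP bitAtFn_mem_FP (fanoutFn_mem_FP sndP_mem_FP (comp_mem_FP valF_mem_FP fstP_mem_FP))

/-- `ROWs ∈ P`. [folklore] -/
theorem ROWs_mem_P : ROWs ∈ P :=
  union_mem_P (union_mem_P (setOf_apply_eq_apply_mem_P mbitF_mem_FP (const_mem_FP _))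
    (setOf_apply_eq_apply_mem_P mbitF_mem_FP (const_mem_FP _)))
    (setOf_apply_eq_apply_mem_P vbitF_mem_FP ansF_mem_FP)

/-- `MAINs ∈ P` (`P` is closed under polynomially bounded `∀`). [folklore] -/
theorem MAINs_mem_P : MAINs ∈ P := ballLang_mem_P _ ROWs_mem_P

/-- **The verifier language is in `P`.** [cite: Hirahara2022PartialMCSP, §1.2 p. 4 and Def. 8.4 p. 30] -/
theorem Ver_mem_P : VerStar ∈ P :=
  inter_mem_P (inter_mem_P (inter_mem_P (inter_mem_P (inter_mem_P (inter_mem_P (inter_mem_P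
    (inter_mem_P WF_mem_P WF₂_mem_P) HDR_mem_P) VALID_mem_P) CANON_mem_P) POWs_mem_P) CLEAN_mem_P)
    MAINs_mem_P) (union_mem_P SIZE_mem_P PROJ_mem_P)

/-! ### Reading the conditions on a pair `z = ⟨⟨tte, sb⟩, y⟩` -/

section Reading

variable (tte sb y : List Bool)

/-- `z ∈ WF₂ ↔ tte = ⟨fstP tte, sndP tte⟩`. [folklore] -/
theorem mem_WF₂_iff : boolPair (boolPair tte sb) y ∈ WF₂ ↔ tte = boolPair (fstP tte) (sndP tte) := by
  rw [WF₂, memL_setOf]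
  simp [hdF, bdF, fanoutFn_apply]

/-- `z ∈ HDR ↔ fstP tte = 1^{|mask|}`. [folklore] -/
theorem mem_HDR_iff :
    boolPair (boolPair tte sb) y ∈ HDR ↔ fstP tte = unaryEncodeNat (maskT.eval (sndP tte)).length := by
  rw [HDR, memL_setOf, Function.comp_apply, hdF_boolPair, maskF_boolPair]
  rfl

/-- `z ∈ VALID ↔ sndP tte` is a body. [folklore] -/
theorem mem_VALID_iff : boolPair (boolPair tte sb) y ∈ VALID ↔ ∃ L : List (Option Bool), sndP tte = tableBody L := by
  rw [VALID, memL_setOf, Function.comp_apply, bdF_boolPair, validT_eval_eq_iff]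

/-- `z ∈ POWs ↔ |mask| = 2^{|ν|}`. [folklore] -/
theorem mem_POWs_iff :
    boolPair (boolPair tte sb) y ∈ POWs ↔ (maskT.eval (sndP tte)).length = 2 ^ (fstP y).length := by
  rw [POWs, memL_preimage, fanoutFn_apply, fanoutFn_apply, maskF_boolPair, sbF_boolPair, sndP_boolPair,
    mem_POW_iff]

/-- The rows of `MAINs`: `z ∈ MAINs ↔ ∀ i < |z|, ⟨z, 1ⁱ⟩ ∈ ROWs`. [folklore] -/
theorem mem_MAINs_iff (z : List Bool) : z ∈ MAINs ↔ ∀ i < z.length, boolPair z (ones i) ∈ ROWs := by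
  simp [MAINs, ones]

/-- Reading a row: `⟨z, 1ⁱ⟩ ∈ ROWs` iff `i ≥ |mask|`, or `mask[i] = 0`, or `[val[i]]` is the
evaluator's answer on `⟨lowBits |ν| i, D⟩`. [cite: Hirahara2022PartialMCSP, §1.2 p. 4 and Def. 8.4 p. 30] -/
theorem mem_ROWs_iff (i : ℕ) : boolPair (boolPair (boolPair tte sb) y) (ones i) ∈ ROWs ↔
    ((maskT.eval (sndP tte)).drop i).take 1 = [] ∨ ((maskT.eval (sndP tte)).drop i).take 1 = [false] ∨
      ((valT.eval (sndP tte)).drop i).take 1 =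
        evalFn (boolPair (List.ofFn (lowBits (fstP y).length i)) (sndP y)) := by
  rw [ROWs, memL_sup, memL_sup, memL_setOf, memL_setOf, memL_setOf, or_assoc]
  simp only [mbitF, vbitF, ansF, argF, Function.comp_apply, fanoutFn_apply, sndP_boolPair, fstP_boolPair,
    maskF_boolPair, valF_boolPair, nuF_boolPair, prF_boolPair, bitAtFn_boolPair, unToBinFn_apply,
    padTakeFn_boolPair, takeD_encodeNat]
  simp [ones]

end Reading

/-! ### Soundness -/

/-- **Soundness of the verifier**: an accepted pair `⟨x, y⟩` has `x ∈ MCSP*`. From `WF`, `WF₂`,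
`VALID`, `HDR`, `CANON`: `x = ⟨enc L, bin s⟩` for a list `L` of optional bits, of length `2ⁿ`
(`n = |ν|`) by `POWs`, i.e. `x` is the instance of the partial truth table `T = L`; from `CLEAN`
and `SIZE` (Theorem R, `exists_circuit_evalFn`) or `PROJ` (a rotation code, `vmSpec_rotCode_proj`)
the program `D` is computed by a `B₂`-circuit of size `≤ s`, which by the rows `i < 2ⁿ ≤ |z|` of
`MAINs` agrees with `T` on its defined entries (`boolFunEquivFin_symm_apply`).
[cite: Hirahara2022PartialMCSP, §1.2 p. 4 and Def. 8.4 p. 30] -/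
theorem sound (x y : List Bool) (h : boolPair x y ∈ VerStar) : x ∈ MCSPStar := by
  have hWF : boolPair x y ∈ WF := h.1.1.1.1.1.1.1.1
  have hWF₂ : boolPair x y ∈ WF₂ := h.1.1.1.1.1.1.1.2
  have hHDR : boolPair x y ∈ HDR := h.1.1.1.1.1.1.2
  have hVALID : boolPair x y ∈ VALID := h.1.1.1.1.1.2
  have hCANON : boolPair x y ∈ CANON := h.1.1.1.1.2
  have hPOW : boolPair x y ∈ POWs := h.1.1.1.2
  have hCLEAN : boolPair x y ∈ CLEAN := h.1.1.2
  have hMAIN : boolPair x y ∈ MAINs := h.1.2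
  have hSP : boolPair x y ∈ MCSPVerif.SIZE ∨ boolPair x y ∈ PROJ := h.2
  clear h
  -- the instance is `⟨⟨1^{|L|}, tableBody L⟩, sb⟩`; read all conditions
  obtain ⟨tte, sb, rfl⟩ : ∃ tte sb, x = boolPair tte sb := ⟨_, _, (mem_WF_iff y x).1 hWF⟩
  obtain ⟨hd, bd, rfl⟩ : ∃ hd bd, tte = boolPair hd bd := ⟨_, _, (mem_WF₂_iff tte sb y).1 hWF₂⟩
  obtain ⟨L, hL⟩ := (mem_VALID_iff _ sb y).1 hVALID
  rw [sndP_boolPair] at hL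
  subst hL
  have hhd := (mem_HDR_iff _ sb y).1 hHDR
  simp only [fstP_boolPair, sndP_boolPair, maskT_eval_tableBody, List.length_map] at hhd
  subst hhd
  have hsb := (mem_CANON_iff _ sb y).1 hCANON
  have hlen := (mem_POWs_iff _ sb y).1 hPOW
  simp only [sndP_boolPair, maskT_eval_tableBody, List.length_map] at hlen
  have hclean := (mem_CLEAN_iff _ sb y).1 hCLEAN
  have hrows := fun i hi => (mem_ROWs_iff _ sb y i).1 ((mem_MAINs_iff _).1 hMAIN i hi)
  have hSP' := hSP.imp (mem_SIZE_iff _ sb y _ hsb).1 (mem_PROJ_iff _ sb y).1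
  clear hWF hWF₂ hHDR hVALID hCANON hPOW hCLEAN hMAIN hSP
  set n := (fstP y).length with hn
  set D := sndP y with hD
  set s := bitsToNat sb with hs
  -- the partial truth table listed by `L`
  set T : Fin (2 ^ n) → Option Bool := fun i => L[(i : ℕ)]'(by omega) with hT
  have hLT : List.ofFn T = L := List.ext_getElem (by simp [hlen]) fun i h₁ h₂ => by simp [hT]
  rw [hsb, ← hLT, ← encode_eq_tableBody]
  -- a small circuit computing the function of the program `D`
  obtain ⟨C, hB, hsize, hC⟩ : ∃ C : Circuit (Fin n), C.IsOver B2 ∧ C.size ≤ s ∧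
      ∀ v : Fin n → Bool, evalFn (boolPair (List.ofFn v) D) = [C.eval v] := by
    rcases hSP' with hSIZE | hPROJ
    · obtain ⟨C, hB, hsize, hC⟩ := exists_circuit_evalFn n D hclean
      exact ⟨C, hB, hsize.trans (max_le hSIZE.1 (Nat.one_le_iff_ne_zero.2 hSIZE.2)), hC⟩
    · obtain ⟨hones, hlen2⟩ := hPROJ
      obtain ⟨k, hk, hrot⟩ : ∃ k, k < n ∧ D = rotCode k :=
        ⟨D.length / 2, by omega, eq_rotCode_of_isClean D.length D le_rfl hones hclean⟩
      refine ⟨Circuit.input ⟨n - 1 - k, by omega⟩, fun g hg => by simp [Circuit.input] at hg,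
        by simp, fun v => ?_⟩
      rw [hrot, evalFn_boolPair, vmSpec_rotCode_proj _ hk, Circuit.eval_input]
  refine ⟨n, T, s, rfl, C, hB, hsize, fun i b hib => ?_⟩
  -- the row `i` of `MAINs`
  have hi : (i : ℕ) < 2 ^ n := i.isLt
  have hLi : L[(i : ℕ)]'(by omega) = some b := hib
  have hlt : (i : ℕ) < (boolPair (boolPair (boolPair (unaryEncodeNat L.length) (tableBody L)) sb) y).length := by
    simp only [length_boolPair, OracleCompose.unaryEncodeNat_eq_replicate, List.length_replicate]; omega
  have hr := hrows i hlt
  simp only [sndP_boolPair, maskT_eval_tableBody, valT_eval_tableBody] at hr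
  rw [List.take_one_drop_eq_of_lt_length (by simp; omega),
    List.take_one_drop_eq_of_lt_length (by simp; omega), hC] at hr
  simp only [List.get_eq_getElem, List.getElem_map, hLi, Option.isSome_some, Option.getD_some,
    List.cons.injEq, and_true, List.cons_ne_self, reduceCtorEq, false_or] at hr
  rw [boolFunEquivFin_symm_apply]
  simpa using hr.symm

/-! ### Completeness -/

/-- All rows of the instance of a list `L` of `2ⁿ` optional bits are consistent with a program
computing a function `g` that agrees with `L` on its defined entries.
[cite: Hirahara2022PartialMCSP, §1.2 p. 4 and Def. 8.4 p. 30] -/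
theorem mem_MAINs_of {n : ℕ} (L : List (Option Bool)) (g : (Fin n → Bool) → Bool) (sb D : List Bool)
    (hD : ∀ v : Fin n → Bool, evalFn (boolPair (List.ofFn v) D) = [g v])
    (hg : ∀ (i : ℕ) (hi : i < L.length) (b : Bool), L[i] = some b → g (lowBits n i) = b) :
    boolPair (boolPair (boolPair (unaryEncodeNat L.length) (tableBody L)) sb) (boolPair (ones n) D) ∈ MAINs := by
  rw [mem_MAINs_iff]
  intro i _
  have hlen : (ones n).length = n := by simp [ones]
  rw [mem_ROWs_iff, fstP_boolPair, sndP_boolPair, sndP_boolPair, maskT_eval_tableBody, valT_eval_tableBody, hlen]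
  by_cases hi : i < L.length
  · rw [List.take_one_drop_eq_of_lt_length (by simpa using hi),
      List.take_one_drop_eq_of_lt_length (by simpa using hi), hD]
    right
    cases hLi : L[i] with
    | none => left; simp [hLi]
    | some b => right; simp [hLi, hg i hi b hLi]
  · left
    rw [List.drop_of_length_le (by simp; omega)]
    rfl

/-- **Completeness of the verifier**: if some `B₂`-circuit `C` of size `≤ s` agrees with the
partial truth table `T`, the instance `⟨enc T, bin s⟩` has a short accepted certificate. Take
an *optimal* circuit `C'` for the total function `C.eval`: it still agrees with `T`, has size
`≤ s`, and size `≤ univBound n < 3 |x|` (`cktSize_univ_fin`); the certificate is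
`⟨1ⁿ, rotCode (n-1-j)⟩` if `C'` has no gate (then `C'` computes `x_j`), else `⟨1ⁿ, progOf C'⟩`,
of length `≤ wlen |x|`. [cite: Hirahara2022PartialMCSP, §1.2 p. 4 and Def. 8.4 p. 30] -/
theorem complete {n : ℕ} (T : Fin (2 ^ n) → Option Bool) (s : ℕ) (C : Circuit (Fin n))
    (hB : C.IsOver B2) (hCs : C.size ≤ s)
    (hT : ∀ (i : Fin (2 ^ n)) (b : Bool), T i = some b → C.eval ((boolFunEquivFin n).symm i) = b) :
    ∃ y : List Bool,
      y.length ≤ wlen.eval (boolPair ((encodingBoolBool.optionBool).listBool.encode (List.ofFn T))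
        (encodeNat s)).length ∧
      boolPair (boolPair ((encodingBoolBool.optionBool).listBool.encode (List.ofFn T)) (encodeNat s)) y
        ∈ VerStar := by
  -- an optimal circuit for the total function computed by `C`, of size at most the universal bound
  obtain ⟨C₀, hB₀, hs₀, hC₀⟩ := (cktSize_univ_fin n fun v (_ : Unit) => C.eval v).toCircuit
  obtain ⟨C', hB', hCf, hCs'⟩ :=
    exists_circuit_size_eq_circuitSizeOver (B := B2) (f := fun v => C.eval v) ⟨C, hB, fun v => rfl⟩
  have hCle : C'.size ≤ s := hCs' ▸ ((circuitSizeOver_le_of_computes C hB fun _ => rfl).trans hCs)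
  have hCu : C'.size + 4 ≤ 5 * 2 ^ n :=
    (Nat.add_le_add_right ((hCs' ▸ circuitSizeOver_le_of_computes C₀ hB₀ hC₀).trans hs₀) 4).trans
      (univBound_le n)
  -- `C'` agrees with `T`
  set L := List.ofFn T with hL
  have hLl : L.length = 2 ^ n := by simp [hL]
  have hg : ∀ (i : ℕ) (hi : i < L.length) (b : Bool), L[i] = some b → C'.eval (lowBits n i) = b := by
    intro i hi b hib
    have hi' : i < 2 ^ n := by omega
    have hTi : T ⟨i, hi'⟩ = some b := by simpa [hL] using hib
    rw [hCf, ← boolFunEquivFin_symm_apply n ⟨i, hi'⟩]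
    exact hT _ b hTi
  -- the instance
  rw [encode_eq_tableBody]
  set x := boolPair (boolPair (unaryEncodeNat L.length) (tableBody L)) (encodeNat s) with hx
  have hxl : 2 * 2 ^ n + 2 ≤ x.length := by
    simp only [hx, length_boolPair, OracleCompose.unaryEncodeNat_eq_replicate, List.length_replicate]
    omega
  have hn : n ≤ 2 ^ n := (Nat.lt_two_pow_self).le
  -- the conditions on the instance
  have hWF : ∀ y, boolPair x y ∈ WF := fun y => (mem_WF_iff y x).2 (by simp [hx])
  have hWF₂ : ∀ y, boolPair x y ∈ WF₂ := fun y => (mem_WF₂_iff _ _ y).2 (by simp)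
  have hHDR : ∀ y, boolPair x y ∈ HDR := fun y => (mem_HDR_iff _ _ y).2 (by simp)
  have hVALID : ∀ y, boolPair x y ∈ VALID := fun y => (mem_VALID_iff _ _ y).2 ⟨L, by simp⟩
  have hCANON : ∀ y, boolPair x y ∈ CANON := fun y => (mem_CANON_iff _ _ y).2 (by simp)
  have hPOW : ∀ D, boolPair x (boolPair (ones n) D) ∈ POWs := fun D =>
    (mem_POWs_iff _ _ _).2 (by simp [ones, hLl])
  by_cases h0 : C'.size = 0
  · -- no gate: `C'` computes the projection to its output wire, an input
    have hgs : C'.gates = [] := List.eq_nil_of_length_eq_zero h0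
    obtain ⟨j, hj⟩ : ∃ j : Fin n, C'.output = .inl j := by
      cases ho : C'.output with
      | inl j => exact ⟨j, rfl⟩
      | inr m => exact absurd (C'.wf_output m ho) (by simp [hgs])
    have hfj : ∀ v, C'.eval v = v j := fun v => by simp [Circuit.eval, hj]
    have hjn : (j : ℕ) < n := j.isLt
    set k := n - 1 - j with hk
    refine ⟨boolPair (ones n) (rotCode k), ?_, ?_⟩
    · simp only [length_boolPair, length_rotCode, wlen_eval, ones, List.length_replicate]
      have hk' : k ≤ n := by omega
      nlinarith [hk', hn, hxl, Nat.zero_le (x.length ^ 2)]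
    · refine ⟨⟨⟨⟨⟨⟨⟨⟨hWF _, hWF₂ _⟩, hHDR _⟩, hVALID _⟩, hCANON _⟩, hPOW _⟩, ?_⟩, ?_⟩, Or.inr ?_⟩
      · exact (mem_CLEAN_iff _ _ _).2 (by simp)
      · refine mem_MAINs_of L (fun v => v j) _ _ (fun v => ?_) fun i hi b hib => ?_
        · rw [evalFn_boolPair, vmSpec_rotCode_proj k (by omega)]
          congr 2
          exact Fin.ext (by simp [hk]; omega)
        · exact (hfj _).symm.trans (hg i hi b hib)
      · refine (mem_PROJ_iff _ _ _).2 ⟨?_, ?_⟩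
        · simp only [sndP_boolPair, length_rotCode]
          clear hk
          induction k with
          | zero => rfl
          | succ k ih => rw [rotCode, ih]; simp [ones, List.replicate_succ, Nat.mul_succ]
        · simp [ones]; omega
  · -- at least one gate: the program of `C'`
    refine ⟨boolPair (ones n) (progOf C'), ?_, ?_⟩
    · have hl := length_progOf_le C'
      simp only [length_boolPair, wlen_eval, ones, List.length_replicate]
      have h1 : C'.size ≤ 3 * x.length := by omega
      have h2 : (C'.size + 1) * (8 * (n + C'.size) + 10) ≤
          (3 * x.length + 1) * (8 * (x.length + 3 * x.length) + 10) :=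
        Nat.mul_le_mul (by omega) (by omega)
      have h3 : (3 * x.length + 1) * (8 * (x.length + 3 * x.length) + 10) =
          96 * x.length ^ 2 + 62 * x.length + 10 := by
        ring
      rw [h3] at h2
      omega
    · refine ⟨⟨⟨⟨⟨⟨⟨⟨hWF _, hWF₂ _⟩, hHDR _⟩, hVALID _⟩, hCANON _⟩, hPOW _⟩, ?_⟩, ?_⟩, Or.inl ?_⟩
      · exact (mem_CLEAN_iff _ _ _).2 (by simp)
      · refine mem_MAINs_of L (fun v => C'.eval v) _ _ (fun v => ?_) hg
        rw [evalFn_boolPair, vmSpec_progOf C' (arity_le_of_isOver hB')]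
      · refine (mem_SIZE_iff _ _ _ s rfl).2 ⟨?_, by omega⟩
        simpa using hCle

end MCSPStarVerif

/-! ### The discharge -/

/-- **Discharge of the named fact `MCSPStar_mem_NP`** (`MCSP.lean`): the partial-function Minimum
Circuit Size Problem `MCSP*` (Hirahara 2022, §1.2 p. 4 and Def. 8.4: instances a partial function
`f : {0,1}ⁿ → {0,1,⋆}` and `s ∈ ℕ`, yes iff some circuit of size `s` computes `f(x)` wherever
`f(x) ≠ ⋆`) is in `NP = ∃ᵖ·P`, with the verifier language `MCSPStarVerif.VerStar ∈ P` (`VerStar_mem_P`: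
guess a circuit, check it on the defined entries) and the witness-length bound `wlen` of
`MCSPProofs.lean` — soundness `sound`, completeness `complete` (an optimal consistent circuit has
size `O(2ⁿ)`, so its program is a polynomially short certificate).
[cite: Hirahara2022PartialMCSP, §1.2 p. 4 and Def. 8.4 p. 30] -/
theorem MCSPStar_mem_NP_holds : MCSPStar_mem_NP := by
  refine ⟨MCSPStarVerif.VerStar, MCSPStarVerif.Ver_mem_P, wlen, fun x => ⟨fun hx => ?_, ?_⟩⟩
  · obtain ⟨n, T, s, rfl, C, hB, hCs, hT⟩ := hx
    exact MCSPStarVerif.complete T s C hB hCs hT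
  · rintro ⟨y, -, hy⟩
    exact MCSPStarVerif.sound x y hy

end Literature.Computability.MetaComplexity
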